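import Mathlib
import HarnessLib

/-!
# NE7 — the torus road's budget in letters: linear-in-`T` majorants and the regime (F284a)

[Balaban1985Variational] Prop 8, row NE7, bookkeeping for F280–F283.  The two closed-form budget
inequalities of F280 `NE7TorusRoadLine.line_of_budget` (`A_r + A_t ≤ θ`,
`A_t(β′ + ε) + A_β β′ ≤ c₀`) are polynomial in the chart constants `(C₀, C₁)`, the total smallness
`T = δ + β′ + ε`, and the two decay factors `ec = e^(−cℓ)`, `ek = e^(−κ′ℓ)`.  Here, in LETTERS:

* `Ar_le`, `At_le`, `Ab_le`: every term of `A_r`, `A_t` carries a factor `T`, `ec` or `ek`, whence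
  `A_r + A_t ≤ T·X + ec·Y + ek·Z` and `A_β ≤ G_β` with `X, Y, Z, G_β` explicit in the letters and in a
  common bound `Cb ≥ 1` of `C₀, C₁` (`P1_le`, `P2_le`, `Q_le_Qb` are the polynomial steps);
* `budgetR_of_regime`, `budgetC_of_regime`: in the regime `θ = 1/4`, `c₀ = ε/8`, `β′ ≤ ε/2`,
  `16·G_β·β′ ≤ ε`, `T·X + ec·Y + ek·Z ≤ 1/24` both budget inequalities hold;
* `growth_Y`, `growth_Z`: with `Cb = A x^p + 1`, `lq ≤ 6x`, `x = ℓ + 1 ≥ 1` the majorants grow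
  polynomially (`Y ≤ Y₀ x^p`, `Z ≤ Z₀ x^(4p+1)`), so that `ec·Y, ek·Z → 0` as `ℓ → ∞`.

Pure real-arithmetic lemmas; instantiated verbatim in F284b `NE7OneStepOfLocalChartRegime`.
-/

namespace Summit.QuantumFields.BalabanUV.T4Continuum.NE7TorusRoadBudgetLetters

/-- `T^i·x ≤ T·y` for `0 ≤ T ≤ 1`, `i ≠ 0`, `0 ≤ x ≤ y`. [folklore] -/
theorem pow_mul_le {T x y : ℝ} (hT0 : 0 ≤ T) (hT1 : T ≤ 1) (hx : 0 ≤ x) (hxy : x ≤ y) {i : ℕ} (hi : i ≠ 0) :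
    T ^ i * x ≤ T * y :=
  mul_le_mul (pow_le_of_le_one hT0 hT1 hi) hxy hx hT0

/-- The first defect polynomial is `≤ 8584·T·Cb⁴`. [folklore] -/
theorem P1_le {T C₀ C₁ Cb : ℝ} (hT0 : 0 ≤ T) (hT1 : T ≤ 1) (hC₀ : 0 ≤ C₀) (hC₀b : C₀ ≤ Cb) (hC₁ : 0 ≤ C₁)
    (hC₁b : C₁ ≤ Cb) (hCb : 1 ≤ Cb) :
    (T * (144 * C₀ * C₁ + 8 * C₁ ^ 2) + T ^ 2 * (5440 * C₀ ^ 3 + 304 * C₁ * C₀ ^ 2) + T ^ 3 * (2688 * C₀ ^ 4)) ≤ T * (8584 * Cb ^ 4) := by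
  have hCb0 : 0 ≤ Cb := zero_le_one.trans hCb
  have h2 : Cb ^ 2 ≤ Cb ^ 4 := pow_le_pow_right₀ hCb (by norm_num)
  have h3 : Cb ^ 3 ≤ Cb ^ 4 := pow_le_pow_right₀ hCb (by norm_num)
  have m1 : C₀ * C₁ ≤ Cb ^ 4 :=
    (mul_le_mul hC₀b hC₁b hC₁ hCb0).trans (le_of_eq_of_le (pow_two Cb).symm h2)
  have m2 : C₁ ^ 2 ≤ Cb ^ 4 := (pow_le_pow_left₀ hC₁ hC₁b 2).trans h2
  have m3 : C₀ ^ 3 ≤ Cb ^ 4 := (pow_le_pow_left₀ hC₀ hC₀b 3).trans h3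
  have m4 : C₁ * C₀ ^ 2 ≤ Cb ^ 4 :=
    (mul_le_mul hC₁b (pow_le_pow_left₀ hC₀ hC₀b 2) (pow_nonneg hC₀ 2) hCb0).trans
      (le_of_eq_of_le (by ring) h3)
  have m5 : C₀ ^ 4 ≤ Cb ^ 4 := pow_le_pow_left₀ hC₀ hC₀b 4
  have e1 : T * (C₀ * C₁) ≤ T * Cb ^ 4 := mul_le_mul_of_nonneg_left m1 hT0
  have e2 : T * C₁ ^ 2 ≤ T * Cb ^ 4 := mul_le_mul_of_nonneg_left m2 hT0
  have e3 : T ^ 2 * C₀ ^ 3 ≤ T * Cb ^ 4 := pow_mul_le hT0 hT1 (pow_nonneg hC₀ 3) m3 two_ne_zero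
  have e4 : T ^ 2 * (C₁ * C₀ ^ 2) ≤ T * Cb ^ 4 :=
    pow_mul_le hT0 hT1 (mul_nonneg hC₁ (pow_nonneg hC₀ 2)) m4 two_ne_zero
  have e5 : T ^ 3 * C₀ ^ 4 ≤ T * Cb ^ 4 := pow_mul_le hT0 hT1 (pow_nonneg hC₀ 4) m5 three_ne_zero
  linarith only [e1, e2, e3, e4, e5]

/-- The second defect polynomial (with `C₁ ↦ C₀ + C₁`) is `≤ 9056·T·Cb⁴`. [folklore] -/
theorem P2_le {T C₀ C₁ Cb : ℝ} (hT0 : 0 ≤ T) (hT1 : T ≤ 1) (hC₀ : 0 ≤ C₀) (hC₀b : C₀ ≤ Cb) (hC₁ : 0 ≤ C₁)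
    (hC₁b : C₁ ≤ Cb) (hCb : 1 ≤ Cb) :
    (T * (144 * C₀ * (C₀ + C₁) + 8 * (C₀ + C₁) ^ 2) + T ^ 2 * (5440 * C₀ ^ 3 + 304 * (C₀ + C₁) * C₀ ^ 2) + T ^ 3 * (2688 * C₀ ^ 4)) ≤ T * (9056 * Cb ^ 4) := by
  have hCb0 : 0 ≤ Cb := zero_le_one.trans hCb
  have h2 : Cb ^ 2 ≤ Cb ^ 4 := pow_le_pow_right₀ hCb (by norm_num)
  have h3 : Cb ^ 3 ≤ Cb ^ 4 := pow_le_pow_right₀ hCb (by norm_num)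
  have hu0 : 0 ≤ C₀ + C₁ := add_nonneg hC₀ hC₁
  have hu : C₀ + C₁ ≤ 2 * Cb := by linarith only [hC₀b, hC₁b]
  have m1 : C₀ * (C₀ + C₁) ≤ 2 * Cb ^ 4 :=
    (mul_le_mul hC₀b hu hu0 hCb0).trans (le_of_eq_of_le (by ring) (mul_le_mul_of_nonneg_left h2 zero_le_two))
  have m2 : (C₀ + C₁) ^ 2 ≤ 4 * Cb ^ 4 :=
    (pow_le_pow_left₀ hu0 hu 2).trans
      (le_of_eq_of_le (by ring) (mul_le_mul_of_nonneg_left h2 (by norm_num : (0:ℝ) ≤ 4)))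
  have m3 : C₀ ^ 3 ≤ Cb ^ 4 := (pow_le_pow_left₀ hC₀ hC₀b 3).trans h3
  have m4 : (C₀ + C₁) * C₀ ^ 2 ≤ 2 * Cb ^ 4 :=
    (mul_le_mul hu (pow_le_pow_left₀ hC₀ hC₀b 2) (pow_nonneg hC₀ 2) (by linarith only [hCb0])).trans
      (le_of_eq_of_le (by ring) (mul_le_mul_of_nonneg_left h3 zero_le_two))
  have m5 : C₀ ^ 4 ≤ Cb ^ 4 := pow_le_pow_left₀ hC₀ hC₀b 4
  have e1 : T * (C₀ * (C₀ + C₁)) ≤ T * (2 * Cb ^ 4) := mul_le_mul_of_nonneg_left m1 hT0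
  have e2 : T * (C₀ + C₁) ^ 2 ≤ T * (4 * Cb ^ 4) := mul_le_mul_of_nonneg_left m2 hT0
  have e3 : T ^ 2 * C₀ ^ 3 ≤ T * Cb ^ 4 := pow_mul_le hT0 hT1 (pow_nonneg hC₀ 3) m3 two_ne_zero
  have e4 : T ^ 2 * ((C₀ + C₁) * C₀ ^ 2) ≤ T * (2 * Cb ^ 4) :=
    pow_mul_le hT0 hT1 (mul_nonneg hu0 (pow_nonneg hC₀ 2)) m4 two_ne_zero
  have e5 : T ^ 3 * C₀ ^ 4 ≤ T * Cb ^ 4 := pow_mul_le hT0 hT1 (pow_nonneg hC₀ 4) m5 three_ne_zero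
  linarith only [e1, e2, e3, e4, e5]

/-- The squared-charge factor is monotone: `Q(C₀T) ≤ Q(Cb)`. [folklore] -/
theorem Q_le_Qb {K₃ K₄ C₀ Cb T : ℝ} (hK₃ : 0 ≤ K₃) (hK₄ : 0 ≤ K₄) (hC₀ : 0 ≤ C₀) (hC₀b : C₀ ≤ Cb) (hT0 : 0 ≤ T)
    (hT1 : T ≤ 1) : (28 * (K₃ + K₄ * (C₀ * T)) ^ 2 + 4 * K₄) ≤ (28 * (K₃ + K₄ * Cb) ^ 2 + 4 * K₄) := by
  have h1 : C₀ * T ≤ Cb := (mul_le_of_le_one_right hC₀ hT1).trans hC₀b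
  have h2 : K₃ + K₄ * (C₀ * T) ≤ K₃ + K₄ * Cb := by linarith only [mul_le_mul_of_nonneg_left h1 hK₄]
  have h0 : 0 ≤ K₃ + K₄ * (C₀ * T) := add_nonneg hK₃ (mul_nonneg hK₄ (mul_nonneg hC₀ hT0))
  linarith only [pow_le_pow_left₀ h0 h2 2]

/-- `A_r ≤ T·(4 K Cc Kd Cb) + ec·(K Cc)`. [folklore] -/
theorem Ar_le {K ec Cc Kd C₀ Cb T : ℝ} (hK : 0 ≤ K) (hec1 : ec ≤ 1) (hCc : 0 ≤ Cc) (hKd : 0 ≤ Kd)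
    (hC₀ : 0 ≤ C₀) (hC₀b : C₀ ≤ Cb) (hT0 : 0 ≤ T) :
    (K * (2 * Cc * Kd * (C₀ * T)) + K * ec * (2 * Cc * Kd * (C₀ * T) + Cc)) ≤ T * (4 * K * Cc * Kd * Cb) + ec * (K * Cc) := by
  have hW : 0 ≤ K * Cc * Kd * T := mul_nonneg (mul_nonneg (mul_nonneg hK hCc) hKd) hT0
  have m1 : (K * Cc * Kd * T) * C₀ ≤ (K * Cc * Kd * T) * Cb := mul_le_mul_of_nonneg_left hC₀b hW
  have m2 : (K * Cc * Kd * T) * (ec * C₀) ≤ (K * Cc * Kd * T) * Cb :=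
    mul_le_mul_of_nonneg_left ((mul_le_mul hec1 hC₀b hC₀ zero_le_one).trans_eq (one_mul Cb)) hW
  linarith only [m1, m2]

/-- `A_t ≤ T·G_T + ec·(8 K cP Cb) + ek·G_K`. [folklore] -/
theorem At_le {K ec ek cP Cg D K₃ K₄ Cd lc lq nF C₀ C₁ Cb T : ℝ} (hK : 0 ≤ K) (hec0 : 0 ≤ ec) (hec1 : ec ≤ 1)
    (hek0 : 0 ≤ ek) (hcP : 0 ≤ cP) (hCg : 0 ≤ Cg) (hD : 0 ≤ D) (hK₃ : 0 ≤ K₃) (hK₄ : 0 ≤ K₄) (hCd : 0 ≤ Cd)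
    (hlc : 0 ≤ lc) (hlq : 0 ≤ lq) (hnF : 0 ≤ nF) (hT0 : 0 ≤ T) (hT1 : T ≤ 1) (hC₀ : 0 ≤ C₀) (hC₀b : C₀ ≤ Cb)
    (hC₁ : 0 ≤ C₁) (hC₁b : C₁ ≤ Cb) (hCb : 1 ≤ Cb) :
    (K * (cP * ((T * (144 * C₀ * C₁ + 8 * C₁ ^ 2) + T ^ 2 * (5440 * C₀ ^ 3 + 304 * C₁ * C₀ ^ 2) + T ^ 3 * (2688 * C₀ ^ 4)) + 2 * (T * (144 * C₀ * (C₀ + C₁) + 8 * (C₀ + C₁) ^ 2) + T ^ 2 * (5440 * C₀ ^ 3 + 304 * (C₀ + C₁) * C₀ ^ 2) + T ^ 3 * (2688 * C₀ ^ 4)))) + K * ec * (cP * ((T * (144 * C₀ * C₁ + 8 * C₁ ^ 2) + T ^ 2 * (5440 * C₀ ^ 3 + 304 * C₁ * C₀ ^ 2) + T ^ 3 * (2688 * C₀ ^ 4)) + 2 * (T * (144 * C₀ * (C₀ + C₁) + 8 * (C₀ + C₁) ^ 2) + T ^ 2 * (5440 * C₀ ^ 3 + 304 * (C₀ + C₁)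 * C₀ ^ 2) + T ^ 3 * (2688 * C₀ ^ 4))) + 4 * cP * (C₀ + C₁)) + nF * Cg * (1 + 12 * D) * ((28 * (K₃ + K₄ * (C₀ * T)) ^ 2 + 4 * K₄) * (C₀ ^ 2 * T)) + (nF * (2 * (Cd * (D * (lc * ek))))) * (K₃ * C₀ + D * lq * (2 * K₃ * C₀ + ((28 * (K₃ + K₄ * (C₀ * T)) ^ 2 + 4 * K₄) * (C₀ ^ 2 * T)))) + 28 * C₀ ^ 2 * T)
      ≤ T * (53392 * K * cP * Cb ^ 4 + nF * Cg * (1 + 12 * D) * (28 * (K₃ + K₄ * Cb) ^ 2 + 4 * K₄) * Cb ^ 2 + 28 * Cb ^ 2) + ec * (8 * K * cP * Cb) + ek * (2 * nF * Cd * D * lc * (K₃ * Cb + D * lq * (2 * K₃ * Cb + (28 * (K₃ + K₄ * Cb) ^ 2 + 4 * K₄) * Cb ^ 2))) := by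
  have hCb0 : 0 ≤ Cb := zero_le_one.trans hCb
  have hP1 := P1_le hT0 hT1 hC₀ hC₀b hC₁ hC₁b hCb
  have hP2 := P2_le hT0 hT1 hC₀ hC₀b hC₁ hC₁b hCb
  have hQ := Q_le_Qb hK₃ hK₄ hC₀ hC₀b hT0 hT1
  set P1 := (T * (144 * C₀ * C₁ + 8 * C₁ ^ 2) + T ^ 2 * (5440 * C₀ ^ 3 + 304 * C₁ * C₀ ^ 2) + T ^ 3 * (2688 * C₀ ^ 4)) with hP1def
  set P2 := (T * (144 * C₀ * (C₀ + C₁) + 8 * (C₀ + C₁) ^ 2) + T ^ 2 * (5440 * C₀ ^ 3 + 304 * (C₀ + C₁) * C₀ ^ 2) + T ^ 3 * (2688 * C₀ ^ 4)) with hP2def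
  set Q := (28 * (K₃ + K₄ * (C₀ * T)) ^ 2 + 4 * K₄) with hQdef
  set Qb := (28 * (K₃ + K₄ * Cb) ^ 2 + 4 * K₄) with hQbdef
  have hQb0 : 0 ≤ Qb := add_nonneg (mul_nonneg (by norm_num) (sq_nonneg _)) (mul_nonneg (by norm_num) hK₄)
  -- the polynomial bracket `X = cP·P1 + 2·P2 ≤ T·Cb⁴(8584 cP + 18112)`
  have hX : cP * (P1 + 2 * P2) ≤ T * (26696 * cP * Cb ^ 4) := by
    have a := mul_le_mul_of_nonneg_left (add_le_add hP1 (mul_le_mul_of_nonneg_left hP2 (zero_le_two (α := ℝ)))) hcP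
    linarith only [a]
  have hXb0 : 0 ≤ T * (26696 * cP * Cb ^ 4) :=
    mul_nonneg hT0 (mul_nonneg (mul_nonneg (by norm_num) hcP) (pow_nonneg hCb0 4))
  -- term 1
  have t1 : K * (cP * (P1 + 2 * P2)) ≤ K * (T * (26696 * cP * Cb ^ 4)) := mul_le_mul_of_nonneg_left hX hK
  -- term 2
  have t2a : K * ec * (cP * (P1 + 2 * P2)) ≤ K * (T * (26696 * cP * Cb ^ 4)) := by
    have b1 : ec * (K * (cP * (P1 + 2 * P2))) ≤ ec * (K * (T * (26696 * cP * Cb ^ 4))) :=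
      mul_le_mul_of_nonneg_left t1 hec0
    have b2 : ec * (K * (T * (26696 * cP * Cb ^ 4))) ≤ K * (T * (26696 * cP * Cb ^ 4)) :=
      mul_le_of_le_one_left (mul_nonneg hK hXb0) hec1
    linarith only [b1, b2]
  have t2b : K * ec * (4 * cP * (C₀ + C₁)) ≤ ec * (8 * K * cP * Cb) := by
    have b1 : (K * ec * cP) * (C₀ + C₁) ≤ (K * ec * cP) * (Cb + Cb) :=
      mul_le_mul_of_nonneg_left (add_le_add hC₀b hC₁b) (mul_nonneg (mul_nonneg hK hec0) hcP)
    linarith only [b1]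
  -- term 3
  have hC2 : C₀ ^ 2 ≤ Cb ^ 2 := pow_le_pow_left₀ hC₀ hC₀b 2
  have hQC : Q * (C₀ ^ 2 * T) ≤ Qb * (Cb ^ 2 * T) :=
    mul_le_mul hQ (mul_le_mul_of_nonneg_right hC2 hT0) (mul_nonneg (pow_nonneg hC₀ 2) hT0) hQb0
  have t3 : nF * Cg * (1 + 12 * D) * (Q * (C₀ ^ 2 * T)) ≤ nF * Cg * (1 + 12 * D) * (Qb * (Cb ^ 2 * T)) :=
    mul_le_mul_of_nonneg_left hQC (mul_nonneg (mul_nonneg hnF hCg) (by linarith only [hD]))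
  -- term 4
  have hQC1 : Q * (C₀ ^ 2 * T) ≤ Qb * Cb ^ 2 :=
    hQC.trans (mul_le_mul_of_nonneg_left (mul_le_of_le_one_right (pow_nonneg hCb0 2) hT1) hQb0)
  have hin : K₃ * C₀ + D * lq * (2 * K₃ * C₀ + Q * (C₀ ^ 2 * T))
      ≤ K₃ * Cb + D * lq * (2 * K₃ * Cb + Qb * Cb ^ 2) := by
    have c1 : K₃ * C₀ ≤ K₃ * Cb := mul_le_mul_of_nonneg_left hC₀b hK₃
    have c2 : D * lq * (2 * K₃ * C₀ + Q * (C₀ ^ 2 * T)) ≤ D * lq * (2 * K₃ * Cb + Qb * Cb ^ 2) :=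
      mul_le_mul_of_nonneg_left (by linarith only [c1, hQC1]) (mul_nonneg hD hlq)
    linarith only [c1, c2]
  have t4 : (nF * (2 * (Cd * (D * (lc * ek))))) * (K₃ * C₀ + D * lq * (2 * K₃ * C₀ + Q * (C₀ ^ 2 * T)))
      ≤ (nF * (2 * (Cd * (D * (lc * ek))))) * (K₃ * Cb + D * lq * (2 * K₃ * Cb + Qb * Cb ^ 2)) :=
    mul_le_mul_of_nonneg_left hin
      (mul_nonneg hnF (mul_nonneg zero_le_two (mul_nonneg hCd (mul_nonneg hD (mul_nonneg hlc hek0)))))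
  -- term 5
  have t5 : 28 * C₀ ^ 2 * T ≤ 28 * Cb ^ 2 * T :=
    mul_le_mul_of_nonneg_right (mul_le_mul_of_nonneg_left hC2 (by norm_num)) hT0
  linarith only [t1, t2a, t2b, t3, t4, t5]

/-- `A_β ≤ G_β` (drop `ek ≤ 1`). [folklore] -/
theorem Ab_le {ek Cg D Cd lc lq nF : ℝ} (hek1 : ek ≤ 1) (hCd : 0 ≤ Cd) (hD : 0 ≤ D) (hlc : 0 ≤ lc) (hlq : 0 ≤ lq)
    (hnF : 0 ≤ nF) :
    (nF * Cg * (1 + 12 * D) + (nF * (2 * (Cd * (D * (lc * ek))))) * (D * lq)) ≤ (nF * Cg * (1 + 12 * D) + 2 * nF * Cd * D * D * lc * lq) := by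
  have hW : 0 ≤ nF * Cd * D * D * lc * lq :=
    mul_nonneg (mul_nonneg (mul_nonneg (mul_nonneg (mul_nonneg hnF hCd) hD) hD) hlc) hlq
  have m : (nF * Cd * D * D * lc * lq) * ek ≤ (nF * Cd * D * D * lc * lq) * 1 := mul_le_mul_of_nonneg_left hek1 hW
  linarith only [m]

/-- **The radius budget in the regime**: `A_r + A_t ≤ 1/4` once `T·X + ec·Y + ek·Z ≤ 1/24`
(with any `Cc' ≥ Cc` in `X, Y`). [folklore] -/
theorem budgetR_of_regime {K ec ek Cc Cc' Kd cP Cg D K₃ K₄ Cd lc lq nF C₀ C₁ Cb T : ℝ} (hK : 0 ≤ K) (hec0 : 0 ≤ ec)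
    (hec1 : ec ≤ 1) (hek0 : 0 ≤ ek) (hCc : 0 ≤ Cc) (hCc' : Cc ≤ Cc') (hKd : 0 ≤ Kd) (hcP : 0 ≤ cP) (hCg : 0 ≤ Cg)
    (hD : 0 ≤ D) (hK₃ : 0 ≤ K₃) (hK₄ : 0 ≤ K₄) (hCd : 0 ≤ Cd) (hlc : 0 ≤ lc) (hlq : 0 ≤ lq) (hnF : 0 ≤ nF)
    (hT0 : 0 ≤ T) (hT1 : T ≤ 1) (hC₀ : 0 ≤ C₀) (hC₀b : C₀ ≤ Cb) (hC₁ : 0 ≤ C₁) (hC₁b : C₁ ≤ Cb) (hCb : 1 ≤ Cb)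
    (hS : T * (4 * K * Cc' * Kd * Cb + (53392 * K * cP * Cb ^ 4 + nF * Cg * (1 + 12 * D) * (28 * (K₃ + K₄ * Cb) ^ 2 + 4 * K₄) * Cb ^ 2 + 28 * Cb ^ 2)) + ec * (K * Cc' + 8 * K * cP * Cb) + ek * (2 * nF * Cd * D * lc * (K₃ * Cb + D * lq * (2 * K₃ * Cb + (28 * (K₃ + K₄ * Cb) ^ 2 + 4 * K₄) * Cb ^ 2))) ≤ 1 / 24) :
    (K * (2 * Cc * Kd * (C₀ * T)) + K * ec * (2 * Cc * Kd * (C₀ * T) + Cc)) + (K * (cP * ((T * (144 * C₀ * C₁ + 8 * C₁ ^ 2) + T ^ 2 * (5440 * C₀ ^ 3 + 304 * C₁ * C₀ ^ 2) + T ^ 3 * (2688 * C₀ ^ 4)) + 2 * (T * (144 * C₀ * (C₀ + C₁) + 8 * (C₀ + C₁) ^ 2) + T ^ 2 * (5440 * C₀ ^ 3 + 304 * (C₀ + C₁) * C₀ ^ 2) + T ^ 3 * (2688 * C₀ ^ 4)))) + K * ec * (cP * ((T * (144 * C₀ * C₁ + 8 * C₁ ^ 2) + T ^ 2 * (5440 *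 C₀ ^ 3 + 304 * C₁ * C₀ ^ 2) + T ^ 3 * (2688 * C₀ ^ 4)) + 2 * (T * (144 * C₀ * (C₀ + C₁) + 8 * (C₀ + C₁) ^ 2) + T ^ 2 * (5440 * C₀ ^ 3 + 304 * (C₀ + C₁) * C₀ ^ 2) + T ^ 3 * (2688 * C₀ ^ 4))) + 4 * cP * (C₀ + C₁)) + nF * Cg * (1 + 12 * D) * ((28 * (K₃ + K₄ * (C₀ * T)) ^ 2 + 4 * K₄) * (C₀ ^ 2 * T)) + (nF * (2 * (Cd * (D * (lc * ek))))) * (K₃ * C₀ + D * lq * (2 * K₃ * C₀ + ((28 * (K₃ + K₄ * (C₀ * T)) ^ 2 + 4 * K₄) * (C₀ ^ 2 * T)))) + 28 * C₀ ^ 2 * T) ≤ 1 / 4 := by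
  have hA := Ar_le hK hec1 hCc hKd hC₀ hC₀b hT0
  have hB := At_le hK hec0 hec1 hek0 hcP hCg hD hK₃ hK₄ hCd hlc hlq hnF hT0 hT1 hC₀ hC₀b hC₁ hC₁b hCb
  have hCb0 : 0 ≤ Cb := zero_le_one.trans hCb
  have m1 : (T * (4 * K * Kd * Cb)) * Cc ≤ (T * (4 * K * Kd * Cb)) * Cc' :=
    mul_le_mul_of_nonneg_left hCc' (mul_nonneg hT0 (mul_nonneg (mul_nonneg (mul_nonneg (by norm_num) hK) hKd) hCb0))
  have m2 : (ec * K) * Cc ≤ (ec * K) * Cc' := mul_le_mul_of_nonneg_left hCc' (mul_nonneg hec0 hK)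
  linarith only [hA, hB, hS, m1, m2]

/-- **The coupling budget in the regime**: `A_t(β′ + ε) + A_β β′ ≤ ε/8` once `T·X + ec·Y + ek·Z ≤ 1/24`,
`β′ ≤ ε/2` and `16·G_β·β′ ≤ ε`. [folklore] -/
theorem budgetC_of_regime {K ec ek Cc Cc' Kd cP Cg D K₃ K₄ Cd lc lq nF C₀ C₁ Cb T βp ε : ℝ} (hK : 0 ≤ K)
    (hec0 : 0 ≤ ec) (hec1 : ec ≤ 1) (hek0 : 0 ≤ ek) (hek1 : ek ≤ 1) (hCc : 0 ≤ Cc) (hCc' : Cc ≤ Cc') (hKd : 0 ≤ Kd)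
    (hcP : 0 ≤ cP) (hCg : 0 ≤ Cg) (hD : 0 ≤ D) (hK₃ : 0 ≤ K₃) (hK₄ : 0 ≤ K₄) (hCd : 0 ≤ Cd) (hlc : 0 ≤ lc)
    (hlq : 0 ≤ lq) (hnF : 0 ≤ nF) (hT0 : 0 ≤ T) (hT1 : T ≤ 1) (hC₀ : 0 ≤ C₀) (hC₀b : C₀ ≤ Cb) (hC₁ : 0 ≤ C₁)
    (hC₁b : C₁ ≤ Cb) (hCb : 1 ≤ Cb) (hε : 0 ≤ ε) (hβp0 : 0 ≤ βp) (hβp1 : βp ≤ ε / 2)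
    (hβp2 : 16 * (nF * Cg * (1 + 12 * D) + 2 * nF * Cd * D * D * lc * lq) * βp ≤ ε)
    (hS : T * (4 * K * Cc' * Kd * Cb + (53392 * K * cP * Cb ^ 4 + nF * Cg * (1 + 12 * D) * (28 * (K₃ + K₄ * Cb) ^ 2 + 4 * K₄) * Cb ^ 2 + 28 * Cb ^ 2)) + ec * (K * Cc' + 8 * K * cP * Cb) + ek * (2 * nF * Cd * D * lc * (K₃ * Cb + D * lq * (2 * K₃ * Cb + (28 * (K₃ + K₄ * Cb) ^ 2 + 4 * K₄) * Cb ^ 2))) ≤ 1 / 24) :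
    (K * (cP * ((T * (144 * C₀ * C₁ + 8 * C₁ ^ 2) + T ^ 2 * (5440 * C₀ ^ 3 + 304 * C₁ * C₀ ^ 2) + T ^ 3 * (2688 * C₀ ^ 4)) + 2 * (T * (144 * C₀ * (C₀ + C₁) + 8 * (C₀ + C₁) ^ 2) + T ^ 2 * (5440 * C₀ ^ 3 + 304 * (C₀ + C₁) * C₀ ^ 2) + T ^ 3 * (2688 * C₀ ^ 4)))) + K * ec * (cP * ((T * (144 * C₀ * C₁ + 8 * C₁ ^ 2) + T ^ 2 * (5440 * C₀ ^ 3 + 304 * C₁ * C₀ ^ 2) + T ^ 3 * (2688 * C₀ ^ 4)) + 2 * (T * (144 * C₀ * (C₀ + C₁) + 8 * (C₀ + C₁) ^ 2) + T ^ 2 * (5440 * C₀ ^ 3 + 304 * (C₀ + C₁) * C₀ ^ 2) + T ^ 3 * (2688 * C₀ ^ 4))) + 4 * cP * (C₀ + C₁)) + nF * Cg * (1 + 12 * D) * ((28 * (K₃ + K₄ * (C₀ * T)) ^ 2 + 4 * K₄) * (C₀ ^ 2 * T)) + (nF * (2 * (Cd * (D * (lc * ek))))) * (K₃ * C₀ +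 D * lq * (2 * K₃ * C₀ + ((28 * (K₃ + K₄ * (C₀ * T)) ^ 2 + 4 * K₄) * (C₀ ^ 2 * T)))) + 28 * C₀ ^ 2 * T) * (βp + ε) + (nF * Cg * (1 + 12 * D) + (nF * (2 * (Cd * (D * (lc * ek))))) * (D * lq)) * βp ≤ ε / 8 := by
  have hB := At_le hK hec0 hec1 hek0 hcP hCg hD hK₃ hK₄ hCd hlc hlq hnF hT0 hT1 hC₀ hC₀b hC₁ hC₁b hCb
  have hG := Ab_le hek1 hCd hD hlc hlq hnF (Cg := Cg)
  have hCb0 : 0 ≤ Cb := zero_le_one.trans hCb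
  have m1 : (T * (4 * K * Kd * Cb)) * Cc' ≥ 0 :=
    mul_nonneg (mul_nonneg hT0 (mul_nonneg (mul_nonneg (mul_nonneg (by norm_num) hK) hKd) hCb0)) (hCc.trans hCc')
  have m2 : (ec * K) * Cc' ≥ 0 := mul_nonneg (mul_nonneg hec0 hK) (hCc.trans hCc')
  have hAt : (K * (cP * ((T * (144 * C₀ * C₁ + 8 * C₁ ^ 2) + T ^ 2 * (5440 * C₀ ^ 3 + 304 * C₁ * C₀ ^ 2) + T ^ 3 * (2688 * C₀ ^ 4)) + 2 * (T * (144 * C₀ * (C₀ + C₁) + 8 * (C₀ + C₁) ^ 2) + T ^ 2 * (5440 * C₀ ^ 3 + 304 * (C₀ + C₁) * C₀ ^ 2) + T ^ 3 * (2688 * C₀ ^ 4)))) + K * ec * (cP * ((T * (144 * C₀ * C₁ + 8 * C₁ ^ 2) + T ^ 2 * (5440 * C₀ ^ 3 + 304 * C₁ * C₀ ^ 2) + T ^ 3 * (2688 * C₀ ^ 4)) + 2 * (T * (144 * C₀ * (C₀ + C₁) + 8 * (C₀ + C₁) ^ 2) + T ^ 2 * (5440 * C₀ ^ 3 + 304 *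 (C₀ + C₁) * C₀ ^ 2) + T ^ 3 * (2688 * C₀ ^ 4))) + 4 * cP * (C₀ + C₁)) + nF * Cg * (1 + 12 * D) * ((28 * (K₃ + K₄ * (C₀ * T)) ^ 2 + 4 * K₄) * (C₀ ^ 2 * T)) + (nF * (2 * (Cd * (D * (lc * ek))))) * (K₃ * C₀ + D * lq * (2 * K₃ * C₀ + ((28 * (K₃ + K₄ * (C₀ * T)) ^ 2 + 4 * K₄) * (C₀ ^ 2 * T)))) + 28 * C₀ ^ 2 * T) ≤ 1 / 24 := by
    linarith only [hB, hS, m1, m2]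
  have p1 := mul_le_mul_of_nonneg_right hAt (add_nonneg hβp0 hε)
  have p2 := mul_le_mul_of_nonneg_right hG hβp0
  linarith only [p1, p2, hβp1, hβp2, hε]

/-- Growth of `Y = K Cc' + 8 K cP Cb` with `Cb = A x^p + 1`, `x ≥ 1`. [folklore] -/
theorem growth_Y {K Cc' cP A x : ℝ} {p : ℕ} (hK : 0 ≤ K) (hCc : 0 ≤ Cc') (hcP : 0 ≤ cP) (hx : 1 ≤ x) :
    K * Cc' + 8 * K * cP * (A * x ^ p + 1) ≤ (K * Cc' + 8 * K * cP * (A + 1)) * x ^ p := by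
  have hxp : 1 ≤ x ^ p := one_le_pow₀ hx
  have m1 : K * Cc' * 1 ≤ K * Cc' * x ^ p := mul_le_mul_of_nonneg_left hxp (mul_nonneg hK hCc)
  have m2 : 8 * K * cP * 1 ≤ 8 * K * cP * x ^ p :=
    mul_le_mul_of_nonneg_left hxp (mul_nonneg (mul_nonneg (by norm_num) hK) hcP)
  nlinarith only [m1, m2]

/-- Growth of `Z = G_K` with `Cb = A x^p + 1`, `lq ≤ 6x`, `x ≥ 1`: `Z ≤ Z₀·x^(4p+1)`. [folklore] -/
theorem growth_Z {K₃ K₄ Cd D lc lq nF A x : ℝ} {p : ℕ} (hK₃ : 0 ≤ K₃) (hK₄ : 0 ≤ K₄) (hCd : 0 ≤ Cd) (hD : 0 ≤ D)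
    (hlc : 0 ≤ lc) (hnF : 0 ≤ nF) (hA : 0 ≤ A) (hx : 1 ≤ x) (hlqx : lq ≤ 6 * x) :
    (2 * nF * Cd * D * lc * (K₃ * (A * x ^ p + 1) + D * lq * (2 * K₃ * (A * x ^ p + 1) + (28 * (K₃ + K₄ * (A * x ^ p + 1)) ^ 2 + 4 * K₄) * (A * x ^ p + 1) ^ 2)))
      ≤ (2 * nF * Cd * D * lc * (K₃ * (A + 1) + D * 6 * (2 * K₃ * (A + 1) + (28 * (K₃ + K₄ * (A + 1)) ^ 2 + 4 * K₄) * (A + 1) ^ 2))) * x ^ (4 * p + 1) := by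
  have hx0 : 0 ≤ x := zero_le_one.trans hx
  have hxp : 1 ≤ x ^ p := one_le_pow₀ hx
  have hxp0 : 0 ≤ x ^ p := zero_le_one.trans hxp
  set Cb := A * x ^ p + 1 with hCbdef
  have hCb0 : 0 ≤ Cb := add_nonneg (mul_nonneg hA hxp0) zero_le_one
  have hCb : Cb ≤ (A + 1) * x ^ p := by rw [hCbdef]; nlinarith only [hxp, hA]
  have hA1 : 0 ≤ A + 1 := by linarith only [hA]
  set Qb := (28 * (K₃ + K₄ * Cb) ^ 2 + 4 * K₄) with hQbdef
  set Qb₀ := (28 * (K₃ + K₄ * (A + 1)) ^ 2 + 4 * K₄) with hQb₀def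
  have hQb0 : 0 ≤ Qb := add_nonneg (mul_nonneg (by norm_num) (sq_nonneg _)) (mul_nonneg (by norm_num) hK₄)
  have hQb₀0 : 0 ≤ Qb₀ := add_nonneg (mul_nonneg (by norm_num) (sq_nonneg _)) (mul_nonneg (by norm_num) hK₄)
  -- `Qb ≤ Qb₀·x^(2p)`
  have hQ : Qb ≤ Qb₀ * x ^ (2 * p) := by
    have q1 : K₃ + K₄ * Cb ≤ (K₃ + K₄ * (A + 1)) * x ^ p := by
      have a1 : K₃ * 1 ≤ K₃ * x ^ p := mul_le_mul_of_nonneg_left hxp hK₃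
      have a2 : K₄ * Cb ≤ K₄ * ((A + 1) * x ^ p) := mul_le_mul_of_nonneg_left hCb hK₄
      nlinarith only [a1, a2]
    have q0 : 0 ≤ K₃ + K₄ * Cb := add_nonneg hK₃ (mul_nonneg hK₄ hCb0)
    have q2 := pow_le_pow_left₀ q0 q1 2
    have q3 : 4 * K₄ * 1 ≤ 4 * K₄ * x ^ (2 * p) :=
      mul_le_mul_of_nonneg_left (one_le_pow₀ hx) (mul_nonneg (by norm_num) hK₄)
    have e : ((K₃ + K₄ * (A + 1)) * x ^ p) ^ 2 = (K₃ + K₄ * (A + 1)) ^ 2 * x ^ (2 * p) := by ring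
    rw [hQbdef, hQb₀def]; nlinarith only [q2, q3, e]
  -- powers of `x`
  have hp1 : x ^ p ≤ x ^ (4 * p + 1) := pow_le_pow_right₀ hx (by omega)
  have hp2 : x * x ^ p ≤ x ^ (4 * p + 1) := by
    rw [← pow_succ']; exact pow_le_pow_right₀ hx (by omega)
  have hp3 : x * x ^ (2 * p) * (x ^ p) ^ 2 = x ^ (4 * p + 1) := by ring
  -- the three inner terms
  have f1 : K₃ * Cb ≤ K₃ * (A + 1) * x ^ (4 * p + 1) := by
    have := mul_le_mul_of_nonneg_left (hCb.trans (mul_le_mul_of_nonneg_left hp1 hA1)) hK₃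
    linarith only [this]
  have f2 : lq * Cb ≤ 6 * (A + 1) * x ^ (4 * p + 1) := by
    have a := mul_le_mul hlqx hCb hCb0 (by linarith only [hx0])
    have b : 6 * x * ((A + 1) * x ^ p) = 6 * (A + 1) * (x * x ^ p) := by ring
    have c := mul_le_mul_of_nonneg_left hp2 (by linarith only [hA1] : (0:ℝ) ≤ 6 * (A + 1))
    linarith only [a, b, c]
  have f3 : lq * (Qb * Cb ^ 2) ≤ 6 * (Qb₀ * (A + 1) ^ 2) * x ^ (4 * p + 1) := by
    have hCb2 : Cb ^ 2 ≤ ((A + 1) * x ^ p) ^ 2 := pow_le_pow_left₀ hCb0 hCb 2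
    have a : Qb * Cb ^ 2 ≤ (Qb₀ * x ^ (2 * p)) * ((A + 1) * x ^ p) ^ 2 :=
      mul_le_mul hQ hCb2 (pow_nonneg hCb0 2) (mul_nonneg hQb₀0 (pow_nonneg hx0 _))
    have b := mul_le_mul hlqx a (mul_nonneg hQb0 (pow_nonneg hCb0 2)) (by linarith only [hx0])
    have c : 6 * x * (Qb₀ * x ^ (2 * p) * ((A + 1) * x ^ p) ^ 2)
        = 6 * (Qb₀ * (A + 1) ^ 2) * x ^ (4 * p + 1) := by
      rw [← hp3]; ring
    linarith only [b, c]
  have hin : K₃ * Cb + D * lq * (2 * K₃ * Cb + Qb * Cb ^ 2)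
      ≤ (K₃ * (A + 1) + D * 6 * (2 * K₃ * (A + 1) + Qb₀ * (A + 1) ^ 2)) * x ^ (4 * p + 1) := by
    have g2 : D * K₃ * (lq * Cb) ≤ D * K₃ * (6 * (A + 1) * x ^ (4 * p + 1)) :=
      mul_le_mul_of_nonneg_left f2 (mul_nonneg hD hK₃)
    have g3 : D * (lq * (Qb * Cb ^ 2)) ≤ D * (6 * (Qb₀ * (A + 1) ^ 2) * x ^ (4 * p + 1)) :=
      mul_le_mul_of_nonneg_left f3 hD
    nlinarith only [f1, g2, g3]
  have hpre : 0 ≤ 2 * nF * Cd * D * lc :=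
    mul_nonneg (mul_nonneg (mul_nonneg (mul_nonneg zero_le_two hnF) hCd) hD) hlc
  have := mul_le_mul_of_nonneg_left hin hpre
  linarith only [this]

end Summit.QuantumFields.BalabanUV.T4Continuum.NE7TorusRoadBudgetLetters
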